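import Mathlib
import Summits.KontsevichZagierPeriods.Zeta5Search.PalindromicKBound
import Summits.KontsevichZagierPeriods.Zeta5Search.CHatReversalProof
import Summits.KontsevichZagierPeriods.Zeta5Search.UniversalDigitDischarge
import HarnessLib

/-!
# ζ(5) search — PARITY VANISHING of the first digits of a centre-free palindromic pair (gen-2 g9 REPORT §1.6, §10)

Cell `pub-zeta5` (HONEST FRAMING: systematic search; no irrationality claim unless certified), typer seat
generation 9.  For a residue class `x` (mod a window prime `p ≤ b₀`) not containing the centre whose exponent vector is PALINDROMIC in
the sense of gen-2 g9's `DoubleDropBonus` / `PalindromicVCarrierBonus` (`netExp s = netExp (T + x − s)` along the class, `T` its top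
point), this file proves

* `pal_invol` : the reflection `s ↦ T + x − s` is a level-reversing involution of the class (the data of the palindrome lemma);
* `cHat_eq_zero_of_pal` : `ĉ_x = 0` when `E_x ≤ −3` is even (so `v(𝒦_x) ≥ 4 + E_x` by U-K);
* `vHat_conj`, `vHat_pal`, `vHat_conj_eq_of_pal` : `v̂_{x̄} = v̂_x` for the conjugate class `x̄` (both equal
  `(−1)^E Σ_q Σ_σ ρ_{q,σ} H^{(σ)}_{L−ℓ_q}` — the conjugation `q ↦ b₀ − q` and the palindrome involution reverse the levels alike);
* `padicNorm_classV_pair_le` : **`v_p(V_x + V_{x̄}) ≥ E_x + 1`** for even `E_x` — the `V`-digits of the pair cancel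
  (U-V `vDigit_holds`, G2 `gHatConj_holds`: `ĝ_{b₀−q} = (−1)^{E+1}ĝ_q = −ĝ_q`).
These are the two "orbit contributes `0` to both leading digits" facts of the double-drop bonus.  `p`-adic valuations of rationals;
nothing about irrationality.
-/

noncomputable section

open Finset

namespace Summit.KontsevichZagierPeriods.Zeta5Search.ClusterValuation

open Summit.KontsevichZagierPeriods.Zeta5Search.DualSeries (InBox)
open Summit.KontsevichZagierPeriods.Zeta5Search.CasoratianValuation (InPolytope)
open Summit.KontsevichZagierPeriods.Zeta5Search.PadicSeries
open Literature.NumberTheory.Transcendental.BallRivoal (harm)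

/-! ### The palindrome involution `s ↦ T + x − s` of the class of `x < p` -/

/-- Arithmetic of the reflection inside the class: `ℓ_s ≤ L` and `τ s = x + p(L − ℓ_s)`, `L = ⌊(b₀ − x)/p⌋`. -/
theorem palTau_eq (b : ℕ → ℤ) {p x s : ℕ} (hp : 0 < p) (hx : x < p) (hs : s ∈ classSet b p x) :
    s / p ≤ ((b 0).toNat - x) / p ∧
      (b 0).toNat - ((b 0).toNat - x) % p - (s - x) = x + p * (((b 0).toNat - x) / p - s / p) := by
  set n := (b 0).toNat with hn
  have hsn : s ≤ n := le_of_mem_classSet b hs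
  have hres : s % p = x := by rw [(mem_filter.1 hs).2, Nat.mod_eq_of_lt hx]
  have h1 := Nat.div_add_mod s p
  have h2 := Nat.div_add_mod (n - x) p
  have h3 := Nat.mod_lt (n - x) hp
  rw [hres] at h1
  have hle : s / p ≤ (n - x) / p := by
    by_contra hlt
    push Not at hlt
    have : p * ((n - x) / p + 1) ≤ p * (s / p) := Nat.mul_le_mul_left _ hlt
    rw [mul_add, mul_one] at this
    omega
  refine ⟨hle, ?_⟩
  obtain ⟨k, hk⟩ := Nat.exists_eq_add_of_le hle
  rw [hk, mul_add] at h2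
  rw [hk, Nat.add_sub_cancel_left]
  omega

/-- **The palindrome involution.**  For `x < p` the reflection `τ s = T + x − s` (`T = b₀ − (b₀ − x) % p` the top point of the class)
maps the class to itself, is an involution, reverses level differences, and `ℓ_{τ s} + ℓ_s = L`. -/
theorem palTau_class (b : ℕ → ℤ) {p x s : ℕ} (hp : 0 < p) (hx : x < p) (hs : s ∈ classSet b p x) :
    (b 0).toNat - ((b 0).toNat - x) % p - (s - x) ∈ classSet b p x ∧
    ((b 0).toNat - ((b 0).toNat - x) % p - (s - x)) / p + s / p = ((b 0).toNat - x) / p ∧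
    (b 0).toNat - ((b 0).toNat - x) % p - (((b 0).toNat - ((b 0).toNat - x) % p - (s - x)) - x) = s ∧
    ((b 0).toNat - ((b 0).toNat - x) % p - (s - x)) + s = 2 * x + p * (((b 0).toNat - x) / p) := by
  obtain ⟨hle, heq⟩ := palTau_eq b hp hx hs
  have hsn : s ≤ (b 0).toNat := le_of_mem_classSet b hs
  have hres : s % p = x := by rw [(mem_filter.1 hs).2, Nat.mod_eq_of_lt hx]
  have h1 := Nat.div_add_mod s p
  have h2 := Nat.div_add_mod ((b 0).toNat - x) p
  have h3 := Nat.mod_lt ((b 0).toNat - x) hp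
  rw [hres] at h1
  obtain ⟨k, hk⟩ := Nat.exists_eq_add_of_le hle
  have hk' : ((b 0).toNat - x) / p - s / p = k := by rw [hk, Nat.add_sub_cancel_left]
  rw [hk'] at heq
  rw [hk, mul_add] at h2
  have hdiv : (x + p * k) / p = k := by rw [Nat.add_mul_div_left _ _ hp, Nat.div_eq_of_lt hx, zero_add]
  have hmem : x + p * k ∈ classSet b p x := by
    refine mem_filter.2 ⟨mem_range.2 (by omega), ?_⟩
    rw [Nat.add_mul_mod_self_left]
  have heq2 := (palTau_eq b hp hx hmem).2
  rw [hdiv, hk, Nat.add_sub_cancel] at heq2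
  have hpk : p * (((b 0).toNat - x) / p) = p * (s / p) + p * k := by rw [hk, mul_add]
  refine ⟨by rwa [heq], by rw [heq, hdiv, hk, Nat.add_comm], ?_, by rw [heq, hpk]; omega⟩
  rw [heq, heq2]
  omega

/-- **The palindrome involution supplies the data of the palindrome lemma** (plus the level relation), for a centre-free class
with palindromic exponent vector. -/
theorem pal_invol (b : ℕ → ℤ) {p x : ℕ} (hp : 0 < p) (hx : x < p) (hcx : ¬ CentreIn b p x)
    (hpal : ∀ s ∈ classSet b p x, netExp b s = netExp b ((b 0).toNat - ((b 0).toNat - x) % p - (s - x))) :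
    ∃ τ : ℕ → ℕ,
      (∀ s ∈ (classSet b p x).filter (fun s => netExp b s ≠ 0), τ s ∈ (classSet b p x).filter (fun s => netExp b s ≠ 0)) ∧
      (∀ s ∈ (classSet b p x).filter (fun s => netExp b s ≠ 0), τ (τ s) = s) ∧
      (∀ s ∈ (classSet b p x).filter (fun s => netExp b s ≠ 0), netExp b (τ s) = netExp b s) ∧
      (∀ s ∈ (classSet b p x).filter (fun s => netExp b s ≠ 0), ∀ t ∈ (classSet b p x).filter (fun s => netExp b s ≠ 0),
        ((τ s : ℚ) - τ t) = -((s : ℚ) - t)) ∧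
      ((¬ (2 : ℤ) ∣ b 0 ∧ CentreIn b p x) → ∀ s ∈ (classSet b p x).filter (fun s => netExp b s ≠ 0),
        (τ s : ℚ) - (b 0 : ℚ) / 2 = -((s : ℚ) - (b 0 : ℚ) / 2)) ∧
      (∀ s ∈ classSet b p x, τ s ∈ classSet b p x ∧ τ (τ s) = s ∧ τ s / p + s / p = ((b 0).toNat - x) / p) := by
  refine ⟨fun s => (b 0).toNat - ((b 0).toNat - x) % p - (s - x), fun s hs => ?_, fun s hs => ?_, fun s hs => ?_,
    fun s hs t ht => ?_, fun h => absurd h.2 hcx, fun s hs => ?_⟩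
  · obtain ⟨hsC, hse⟩ := mem_filter.1 hs
    exact mem_filter.2 ⟨(palTau_class b hp hx hsC).1, by rwa [← hpal s hsC]⟩
  · exact (palTau_class b hp hx (mem_filter.1 hs).1).2.2.1
  · exact (hpal s (mem_filter.1 hs).1).symm
  · have h1 := (palTau_class b hp hx (mem_filter.1 hs).1).2.2.2
    have h2 := (palTau_class b hp hx (mem_filter.1 ht).1).2.2.2
    have h1' : (((b 0).toNat - ((b 0).toNat - x) % p - (s - x) : ℕ) : ℚ) + s = 2 * x + p * ((((b 0).toNat - x) / p : ℕ) : ℚ) := by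
      exact_mod_cast h1
    have h2' : (((b 0).toNat - ((b 0).toNat - x) % p - (t - x) : ℕ) : ℚ) + t = 2 * x + p * ((((b 0).toNat - x) / p : ℕ) : ℚ) := by
      exact_mod_cast h2
    linarith
  · obtain ⟨h1, h2, h3, -⟩ := palTau_class b hp hx hs
    exact ⟨h1, h3, h2⟩

/-! ### `ĉ_x = 0` -/

/-- **`ĉ_x = 0`** for a centre-free class with palindromic exponent vector and even `E_x ≤ −3`. -/
theorem cHat_eq_zero_of_pal (b : ℕ → ℤ) {p x : ℕ} (hb : InPolytope b) (hprime : p.Prime) (hp5 : 5 ≤ p)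
    (hwin : (b 0 + 2 : ℤ) < (p : ℤ) ^ 2) (hx : x < p) (hcx : ¬ CentreIn b p x)
    (hpal : ∀ s ∈ classSet b p x, netExp b s = netExp b ((b 0).toNat - ((b 0).toNat - x) % p - (s - x)))
    (hE3 : classExp b p x ≤ -3) (heven : Even (classExp b p x)) : cHat b p x = 0 := by
  obtain ⟨τ, hD, hinv, he, hlin, hcen, -⟩ := pal_invol b hprime.pos hx hcx hpal
  obtain ⟨hS1, hS2, -⟩ := rhoResidueIdentities_holds b p x hb hprime hp5 hwin hx
  exact cHat_eq_zero_of_invol b τ hD hinv he hlin hcen hprime.pos heven (hS1 (by omega)) (hS2 hE3)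

/-! ### `v̂_{x̄} = v̂_x` -/

/-- **`v̂` of the conjugate class** (centre-free): `v̂_{x̄} = Σ_q Σ_σ (−1)^σ (−1)^{E+σ} ρ_{q,σ} H^{(σ)}_{L − ℓ_q}`. -/
theorem vHat_conj (b : ℕ → ℤ) (h0 : 0 ≤ b 0) {p x : ℕ} (hp : 0 < p) (hx : x < p) (hxn : x ≤ (b 0).toNat)
    (hcx : ¬ CentreIn b p x) :
    vHat b p (conjClass b p x) = ∑ q ∈ classPoles b p x, ∑ σ ∈ Icc 1 (-netExp b q).toNat,
      (-1 : ℚ) ^ σ * ((-1 : ℚ) ^ (classExp b p x + σ) * classRho b p q σ) * harm σ (((b 0).toNat - x) / p - q / p) := by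
  set n := (b 0).toNat with hn
  have hpoles : classPoles b p (conjClass b p x) = (classPoles b p x).image (fun s => n - s) := by
    unfold classPoles
    rw [classSet_conj b hxn, filter_image]
    exact congrArg _ (filter_congr fun s hs => by
      show netExp b (n - s) < 0 ↔ netExp b s < 0
      rw [netExp_reflect b h0 (le_of_mem_classSet b hs)])
  have hinj : Set.InjOn (fun s => n - s) ↑(classPoles b p x) :=
    (reflect_injOn b).mono (coe_subset.2 (filter_subset _ _))
  unfold vHat
  rw [hpoles, sum_image hinj]
  refine sum_congr rfl fun q hq => ?_
  obtain ⟨hqC, -⟩ := mem_filter.1 hq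
  have hqn := le_of_mem_classSet b hqC
  have hl := lvl_reflect_add b hp hqC
  rw [Nat.mod_eq_of_lt hx] at hl
  rw [netExp_reflect b h0 hqn, show (n - q) / p = (n - x) / p - q / p from Nat.eq_sub_of_add_eq hl]
  refine sum_congr rfl fun σ hσ => ?_
  have hσ' : (σ : ℤ) ≤ -netExp b q := by
    have := (mem_Icc.1 hσ).2
    have hq0 : netExp b q < 0 := (mem_filter.1 hq).2
    omega
  rw [classRho_conj b h0 hxn hcx hqC hσ']

/-- **`v̂` of a palindromic class**, reindexed by the palindrome involution: the same double sum. -/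
theorem vHat_pal (b : ℕ → ℤ) {p x : ℕ} (hp : 0 < p) (hx : x < p) (hcx : ¬ CentreIn b p x)
    (hpal : ∀ s ∈ classSet b p x, netExp b s = netExp b ((b 0).toNat - ((b 0).toNat - x) % p - (s - x))) :
    vHat b p x = ∑ q ∈ classPoles b p x, ∑ σ ∈ Icc 1 (-netExp b q).toNat,
      (-1 : ℚ) ^ σ * ((-1 : ℚ) ^ (classExp b p x + σ) * classRho b p q σ) * harm σ (((b 0).toNat - x) / p - q / p) := by
  obtain ⟨τ, hD, hinv, he, hlin, hcen, hcls⟩ := pal_invol b hp hx hcx hpal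
  set D := (classSet b p x).filter (fun s => netExp b s ≠ 0) with hDdef
  set P := classPoles b p x with hPdef
  have hPD : ∀ s ∈ P, s ∈ D := fun s hs => by
    obtain ⟨hs1, hs2⟩ := mem_filter.1 hs
    exact mem_filter.2 ⟨hs1, by omega⟩
  have hτP : ∀ s ∈ P, τ s ∈ P := fun s hs => by
    have hsD := hPD s hs
    refine mem_filter.2 ⟨(mem_filter.1 (hD s hsD)).1, ?_⟩
    rw [he s hsD]; exact (mem_filter.1 hs).2
  have hflip : vHat b p x = ∑ q ∈ P, ∑ σ ∈ Icc 1 (-netExp b (τ q)).toNat,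
      (-1 : ℚ) ^ σ * classRho b p (τ q) σ * harm σ (τ q / p) := by
    unfold vHat
    exact (sum_nbij' τ τ hτP hτP (fun s hs => hinv s (hPD s hs)) (fun s hs => hinv s (hPD s hs)) (fun _ _ => rfl)).symm
  rw [hflip]
  refine sum_congr rfl fun q hq => ?_
  have hqD := hPD q hq
  have hqC : q ∈ classSet b p x := (mem_filter.1 hq).1
  have hqn := le_of_mem_classSet b hqC
  obtain ⟨-, -, hl⟩ := hcls q hqC
  rw [he q hqD, show τ q / p = ((b 0).toNat - x) / p - q / p from Nat.eq_sub_of_add_eq hl]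
  refine sum_congr rfl fun σ hσ => ?_
  have hσ' : (σ : ℤ) ≤ -netExp b q := by
    have := (mem_Icc.1 hσ).2
    have hq0 : netExp b q < 0 := (mem_filter.1 hq).2
    omega
  rw [classRho_invol b τ hD hinv he hlin hcen hqD hqn hσ']

/-- **`v̂_{x̄} = v̂_x`** for a centre-free class with palindromic exponent vector. -/
theorem vHat_conj_eq_of_pal (b : ℕ → ℤ) (h0 : 0 ≤ b 0) {p x : ℕ} (hp : 0 < p) (hx : x < p) (hxn : x ≤ (b 0).toNat)
    (hcx : ¬ CentreIn b p x)
    (hpal : ∀ s ∈ classSet b p x, netExp b s = netExp b ((b 0).toNat - ((b 0).toNat - x) % p - (s - x))) :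
    vHat b p (conjClass b p x) = vHat b p x := by
  rw [vHat_conj b h0 hp hx hxn hcx, vHat_pal b hp hx hcx hpal]

/-! ### The `V`-digits of the pair cancel -/

variable {p : ℕ} [hp : Fact p.Prime]

/-- **`v_p(V_x + V_{x̄}) ≥ E_x + 1`** for a centre-free pole class with palindromic exponent vector and even `E_x`. -/
theorem padicNorm_classV_pair_le (b : ℕ → ℤ) (hb : InPolytope b) (hp5 : 5 ≤ p) (hpn : p ≤ (b 0).toNat)
    (hwin : (b 0 + 2 : ℤ) < (p : ℤ) ^ 2) {x : ℕ} (hx : x < p) (hpole : 1 ≤ classPoleCount b p x) (hcx : ¬ CentreIn b p x)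
    (hpal : ∀ s ∈ classSet b p x, netExp b s = netExp b ((b 0).toNat - ((b 0).toNat - x) % p - (s - x)))
    (heven : Even (classExp b p x)) :
    padicNorm p (classV b p x + classV b p (conjClass b p x)) ≤ (p : ℚ) ^ (-(classExp b p x + 1)) := by
  have hprime := hp.out
  have hp0 : 0 < p := hprime.pos
  have h0 : 0 ≤ b 0 := hb.1.1
  have hxn : x ≤ (b 0).toNat := by omega
  set n := (b 0).toNat with hn
  set E := classExp b p x with hE
  obtain ⟨q, hq⟩ := card_pos.1 (by unfold classPoleCount at hpole; omega :
    0 < ((classSet b p x).filter fun s => netExp b s < 0).card)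
  obtain ⟨hqC, hqpole⟩ := mem_filter.1 hq
  have hqn := le_of_mem_classSet b hqC
  -- the conjugate class and its pole `b₀ − q`
  have hxc : conjClass b p x < p := conjClass_lt b hp0 x
  have hqc : n - q ∈ classSet b p (conjClass b p x) :=
    (mem_classSet_conj_iff b hxn (by omega)).2 (by rwa [Nat.sub_sub_self hqn])
  have hqcpole : netExp b (n - q) < 0 := by rwa [netExp_reflect b h0 hqn]
  have hEc : classExp b p (conjClass b p x) = E := classExp_conj b h0 hxn
  -- the two first digits
  have hV : padicNorm p (classV b p x - (-(p : ℚ)) ^ E * gHat b p q * vHat b p x) ≤ (p : ℚ) ^ (-(E + 1)) :=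
    padicNorm_le_of_val fun hne => vDigit_holds b p x q hb hprime hp5 hwin hx hqC hqpole hne
  have hVc : padicNorm p (classV b p (conjClass b p x)
      - (-(p : ℚ)) ^ E * gHat b p (n - q) * vHat b p (conjClass b p x)) ≤ (p : ℚ) ^ (-(E + 1)) := by
    have h := padicNorm_le_of_val (p := p) fun hne =>
      vDigit_holds b p (conjClass b p x) (n - q) hb hprime hp5 hwin hxc hqc hqcpole hne
    rwa [hEc] at h
  -- `ĝ_{b₀−q} = −ĝ_q`, `v̂_{x̄} = v̂_x`
  have hg : gHat b p (n - q) = -gHat b p q := by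
    rw [gHatConj_holds b p x q hb hprime hp5 hx hcx hqC, (heven.add_odd odd_one).neg_one_zpow]
    ring
  have hv := vHat_conj_eq_of_pal b h0 hp0 hx hxn hcx hpal
  have e : classV b p x + classV b p (conjClass b p x) =
      (classV b p x - (-(p : ℚ)) ^ E * gHat b p q * vHat b p x)
        + (classV b p (conjClass b p x) - (-(p : ℚ)) ^ E * gHat b p (n - q) * vHat b p (conjClass b p x)) := by
    rw [hg, hv]; ring
  rw [e]
  exact (padicNorm.nonarchimedean (p := p)).trans (max_le hV hVc)

end Summit.KontsevichZagierPeriods.Zeta5Search.ClusterValuation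

end
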